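import Summits.Ventures.PercRepro.SixFourResidueThreeOnePoint

/-!
# The `t = 3` clause of `SixFourResidue` — plane + one point at `P = 8` (Proposition 21.5 at `t = 3`, `g ≤ 9`) (p2, gen 9)

`SixFourResidueThreeOnePoint.lean` proves Proposition 21.5 at `t = 3` for plane traces `τ` with `P ≤ 7` points (`g ≤ 8`):
the profile bridge of `SixFourT4Bridge` / `SixFourResidueTwoPointsC–D` is stated for `p ≤ 7`, where every line meets
`τ` in `≤ 6` points.  At `P = 8` two cases: (i) some line meets `τ` in `7` points — then `τ = ℓ ∪ {z}` and every
rank-`4` subset `B″ ∪ {a}` of `G` contains `z`, so its rest `τ ∖ B″ ⊆ ℓ` is collinear: `G` is demand-free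
(`J_three_nonneg_of_plane_add_one_of_line`); (ii) no line meets `τ` in `≥ 7` points — then `inc₇ = 0` and the
`5`-parameter profile `(inc₂, …, inc₆)` describes `τ` exactly as for `p ≤ 7`; the bridge lemmas are re-proved under
`p ≤ 8 ∧ inc₇ = 0` (`sum_inc_range_eight'`, `pair_identity_of_trace8`, `profileOK_of_trace8`, `inc_bounds_of_trace8`
(`inc₃ < 10`, `inc₄ < 5`), `Tcnt_eq8`, `D3cnt_eq8`, `card_four_eq8`, `card_five_eq8`, `LPcnt_le8`), the small sets now
include the rank-`3` `5`-sets (`SmallProf8`, `card_small_le_SmallProf8`), and the profile inequality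
`12·Small ≤ 6·T + 15·D₃ − 5·LP` is decided on the `95` admissible pairwise-OK profiles with `p ≤ 8` (`profCheck3'_holds`;
minimum slack `6` at `p = 3`, `143` at `p = 8`).
Part B = the bridge lemmas (split for the `400`-line limit); the profile inequality, the small count and the
assembly `J_three_nonneg_of_plane_add_one' : (P₀ ∩ G).card + 1 = G.card → G.card ≤ 9 → 0 ≤ J M G 3` are part C
(`SixFourResidueThreeOnePointC.lean`).
-/

namespace PercRepro.SixFour

/-! ## The bridge at `p ≤ 8` with `inc₇ = 0` -/

open Finset ThmH
variable {α : Type*} [DecidableEq α] {M : Matroid α} [M.Finite] {G : Finset α}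

/-- The profile sum of a rank-`3` set with `≤ 8` points runs over `m < 8` (the `m = 8` term vanishes). -/
theorem sum_inc_range_eight' {ρ : Finset α} (hr : M.eRk (ρ : Set α) = 3) (h8 : ρ.card ≤ 8) (f : ℕ → ℕ) :
    ∑ m ∈ Finset.range (ρ.card + 1), inc M ρ m * f m = ∑ m ∈ Finset.range 8, inc M ρ m * f m := by
  rcases Nat.lt_or_ge ρ.card 8 with h | h
  · exact sum_inc_range_eight hr (by omega) f
  · have h8' : ρ.card = 8 := by omega
    rw [h8', Finset.sum_range_succ, inc_eq_zero_of_card_le hr (by omega), zero_mul, add_zero]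

section Counts

variable (hs : Simple M) {τ : Finset α} (hτ : τ ⊆ gr M)
include hs hτ

/-- The pair identity for a rank-`3` trace with `p ≤ 8` points and no `7`-point line. -/
theorem pair_identity_of_trace8 (hr : M.eRk (τ : Set α) = 3) (h8 : τ.card ≤ 8) (hi7 : inc M τ 7 = 0) :
    inc M τ 2 + 3 * inc M τ 3 + 6 * inc M τ 4 + 10 * inc M τ 5 + 15 * inc M τ 6 = τ.card.choose 2 := by
  obtain ⟨c12, c22, c32, c42, c52, c62, c72, -, -, -, -, -, -, -⟩ := choose_values
  have hpair := sum_choose_two_trace hs hτ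
  have ep := sum_lines_eq_sum_inc (M := M) τ (fun n => n.choose 2)
  rw [ep, sum_inc_range_eight' hr h8] at hpair
  simp only [Finset.sum_range_succ, Finset.sum_range_zero, Nat.choose_zero_succ, c12, c22, c32, c42, c52, c62, c72,
    hi7, mul_zero, zero_add, mul_one, zero_mul, add_zero] at hpair
  omega

/-- The profile of a rank-`3` trace with `p ≤ 8` points and no `7`-point line is admissible. -/
theorem profileOK_of_trace8 (hr : M.eRk (τ : Set α) = 3) (h8 : τ.card ≤ 8) (hi7 : inc M τ 7 = 0) :
    ProfileOK τ.card (inc M τ 2) (inc M τ 3) (inc M τ 4) (inc M τ 5) (inc M τ 6) :=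
  ⟨pair_identity_of_trace8 hs hτ hr h8 hi7, three_le_card_of_eRk_eq_three hr,
    fun h => inc_eq_zero_of_card_le hr h, fun h => inc_eq_zero_of_card_le hr h,
    fun h => inc_eq_zero_of_card_le hr h, fun h => inc_eq_zero_of_card_le hr h⟩

omit hτ in
/-- The profile entries of a trace with `p ≤ 8` points are bounded by `C(8,2) = 28`. -/
theorem inc_bounds_of_trace8 (hτ : τ ⊆ gr M) (h8 : τ.card ≤ 8) :
    inc M τ 3 < 10 ∧ inc M τ 4 < 5 ∧ inc M τ 5 < 3 ∧ inc M τ 6 < 2 := by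
  obtain ⟨-, -, c32, c42, c52, c62, -, -, -, -, -, -, -, -⟩ := choose_values
  have hc2 : τ.card.choose 2 ≤ 28 := (Nat.choose_le_choose 2 h8).trans (by decide)
  have hb3 := choose_two_mul_inc_le hs hτ 3
  have hb4 := choose_two_mul_inc_le hs hτ 4
  have hb5 := choose_two_mul_inc_le hs hτ 5
  have hb6 := choose_two_mul_inc_le hs hτ 6
  rw [c32] at hb3
  rw [c42] at hb4
  rw [c52] at hb5
  rw [c62] at hb6
  omega

/-- `Tcnt = TProf` for `p ≤ 8` with no `7`-point line. -/
theorem Tcnt_eq8 (hr : M.eRk (τ : Set α) = 3) (h8 : τ.card ≤ 8) (hi7 : inc M τ 7 = 0) :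
    (Tcnt M τ : ℤ) = TProf τ.card (inc M τ 3) (inc M τ 4) (inc M τ 5) (inc M τ 6) := by
  have e1 : Tcnt M τ = ((τ.powersetCard 3).filter (fun Z : Finset α => M.eRk (Z : Set α) = 3)).card := by
    unfold Tcnt R3
    rw [Finset.powersetCard_eq_filter, Finset.filter_filter, Finset.filter_filter]
    congr 1
    exact Finset.filter_congr (fun Z _ => and_comm)
  have hsplit := Finset.card_filter_add_card_filter_not (s := τ.powersetCard 3)
    (fun Z : Finset α => M.eRk (Z : Set α) = 3)
  have hcongr : (τ.powersetCard 3).filter (fun Z : Finset α => ¬ M.eRk (Z : Set α) = 3) =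
      (τ.powersetCard 3).filter (fun Z : Finset α => M.eRk (Z : Set α) = 2) := by
    refine Finset.filter_congr (fun Z hZ => ?_)
    obtain ⟨hZτ, hc⟩ := Finset.mem_powersetCard.1 hZ
    have hle : M.eRk (Z : Set α) ≤ 3 := by rw [← hr]; exact M.eRk_mono (Finset.coe_subset.2 hZτ)
    constructor
    · intro hne
      refine le_antisymm ?_ (two_le_eRk_of_two_le_card hs hτ hZτ (by omega))
      by_contra h
      exact hne (eRk_eq_of_le_of_not_le (n := 2) hle h)
    · intro h2; rw [h2]; decide
  rw [hcongr, card_rank_two_subsets hs hτ (by norm_num : 2 ≤ 3), Finset.card_powersetCard] at hsplit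
  have e3 := sum_lines_eq_sum_inc (M := M) τ (fun n => n.choose 3)
  rw [e3, sum_inc_range_eight' hr h8] at hsplit
  have hc : Nat.choose 0 3 = 0 ∧ Nat.choose 1 3 = 0 ∧ Nat.choose 2 3 = 0 ∧ Nat.choose 3 3 = 1 ∧ Nat.choose 4 3 = 4 ∧
      Nat.choose 5 3 = 10 ∧ Nat.choose 6 3 = 20 := by decide
  obtain ⟨c0, c1, c2, c3, c4, c5, c6⟩ := hc
  simp only [Finset.sum_range_succ, Finset.sum_range_zero, c0, c1, c2, c3, c4, c5, c6, hi7, mul_zero, zero_add,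
    mul_one, zero_mul, add_zero] at hsplit
  unfold TProf
  rw [e1]
  omega

/-- `D₃cnt = D3Prof` for `p ≤ 8` with no `7`-point line. -/
theorem D3cnt_eq8 (hr : M.eRk (τ : Set α) = 3) (h8 : τ.card ≤ 8) (hi7 : inc M τ 7 = 0) :
    D3cnt M τ = D3Prof τ.card (inc M τ 4) (inc M τ 5) (inc M τ 6) := by
  have e1 : D3cnt M τ = (τ.powerset.filter (fun Z : Finset α => 4 ≤ Z.card ∧ M.eRk (Z : Set α) = 3)).card := by
    unfold D3cnt R3
    rw [Finset.filter_filter]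
    congr 1
    exact Finset.filter_congr (fun Z _ => and_comm)
  obtain ⟨d0, d1, d2, d3, d4, d5, d6⟩ := delta_values
  have hD := D3_add_sum_delta hs hτ hr
  have eD := sum_lines_eq_sum_inc (M := M) τ (fun n => delta n)
  rw [eD, sum_inc_range_eight' hr h8] at hD
  simp only [Finset.sum_range_succ, Finset.sum_range_zero, d0, d1, d2, d3, d4, d5, d6, hi7, mul_zero, zero_add,
    mul_one, zero_mul, add_zero] at hD
  unfold D3Prof
  rw [d4, d5, d6, e1]
  omega

/-- `#{S ∈ R₃(τ) : |S| = k} = C(p,k) − Σ_m C(m,k)·inc_m` for `k ∈ {4, 5}`, `p ≤ 8`, no `7`-point line (the generic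
step shared by `card_four_eq8` and `card_five_eq8`). -/
theorem card_k_eq8 (hr : M.eRk (τ : Set α) = 3) (h8 : τ.card ≤ 8) {k : ℕ} (hk : 2 ≤ k) :
    ((R3 M τ).filter (fun S => S.card = k)).card + ∑ m ∈ Finset.range 8, inc M τ m * m.choose k = τ.card.choose k := by
  have e1 : ((R3 M τ).filter (fun S => S.card = k)).card =
      ((τ.powersetCard k).filter (fun Z : Finset α => M.eRk (Z : Set α) = 3)).card := by
    unfold R3
    rw [Finset.powersetCard_eq_filter, Finset.filter_filter, Finset.filter_filter]
    congr 1
    exact Finset.filter_congr (fun Z _ => and_comm)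
  have hsplit := Finset.card_filter_add_card_filter_not (s := τ.powersetCard k)
    (fun Z : Finset α => M.eRk (Z : Set α) = 3)
  have hcongr : (τ.powersetCard k).filter (fun Z : Finset α => ¬ M.eRk (Z : Set α) = 3) =
      (τ.powersetCard k).filter (fun Z : Finset α => M.eRk (Z : Set α) = 2) := by
    refine Finset.filter_congr (fun Z hZ => ?_)
    obtain ⟨hZτ, hc⟩ := Finset.mem_powersetCard.1 hZ
    have hle : M.eRk (Z : Set α) ≤ 3 := by rw [← hr]; exact M.eRk_mono (Finset.coe_subset.2 hZτ)
    constructor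
    · intro hne
      refine le_antisymm ?_ (two_le_eRk_of_two_le_card hs hτ hZτ (by omega))
      by_contra h
      exact hne (eRk_eq_of_le_of_not_le (n := 2) hle h)
    · intro h2; rw [h2]; decide
  rw [hcongr, card_rank_two_subsets hs hτ hk, Finset.card_powersetCard] at hsplit
  have ek := sum_lines_eq_sum_inc (M := M) τ (fun n => n.choose k)
  rw [ek, sum_inc_range_eight' hr h8] at hsplit
  rw [e1]
  exact hsplit

/-- `#{S ∈ R₃(τ) : |S| = 4} = r34Prof` for `p ≤ 8` with no `7`-point line. -/
theorem card_four_eq8 (hr : M.eRk (τ : Set α) = 3) (h8 : τ.card ≤ 8) (hi7 : inc M τ 7 = 0) :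
    ((R3 M τ).filter (fun S => S.card = 4)).card = r34Prof τ.card (inc M τ 4) (inc M τ 5) (inc M τ 6) := by
  have h := card_k_eq8 hs hτ hr h8 (by norm_num : 2 ≤ 4)
  have hc : Nat.choose 0 4 = 0 ∧ Nat.choose 1 4 = 0 ∧ Nat.choose 2 4 = 0 ∧ Nat.choose 3 4 = 0 ∧ Nat.choose 4 4 = 1 ∧
      Nat.choose 5 4 = 5 ∧ Nat.choose 6 4 = 15 := by decide
  obtain ⟨c0, c1, c2, c3, c4, c5, c6⟩ := hc
  simp only [Finset.sum_range_succ, Finset.sum_range_zero, c0, c1, c2, c3, c4, c5, c6, hi7, mul_zero, zero_add,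
    mul_one, zero_mul, add_zero] at h
  unfold r34Prof
  omega

/-- `#{S ∈ R₃(τ) : |S| = 5} = C(p,5) − inc₅ − 6·inc₆` for `p ≤ 8` with no `7`-point line. -/
theorem card_five_eq8 (hr : M.eRk (τ : Set α) = 3) (h8 : τ.card ≤ 8) (hi7 : inc M τ 7 = 0) :
    ((R3 M τ).filter (fun S => S.card = 5)).card = τ.card.choose 5 - (inc M τ 5 * 1 + inc M τ 6 * 6) := by
  have h := card_k_eq8 hs hτ hr h8 (by norm_num : 2 ≤ 5)
  have hc : Nat.choose 0 5 = 0 ∧ Nat.choose 1 5 = 0 ∧ Nat.choose 2 5 = 0 ∧ Nat.choose 3 5 = 0 ∧ Nat.choose 4 5 = 0 ∧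
      Nat.choose 5 5 = 1 ∧ Nat.choose 6 5 = 6 := by decide
  obtain ⟨c0, c1, c2, c3, c4, c5, c6⟩ := hc
  simp only [Finset.sum_range_succ, Finset.sum_range_zero, c0, c1, c2, c3, c4, c5, c6, hi7, mul_zero, zero_add,
    mul_one, zero_mul, add_zero] at h
  omega

/-- `LP ≤ LPProf` for `p ≤ 8` with no `7`-point line (the surjection of `LPcnt_le`, re-counted). -/
theorem LPcnt_le8 (hr : M.eRk (τ : Set α) = 3) (h8 : τ.card ≤ 8) (hi7 : inc M τ 7 = 0) :
    (LPcnt M τ : ℤ) ≤ LPProf τ.card (inc M τ 3) (inc M τ 4) (inc M τ 5) (inc M τ 6) := by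
  set T := (lines M).sigma (fun L => ((L ∩ τ).powerset.filter (fun C : Finset α => 3 ≤ C.card)) ×ˢ (τ \ L)) with hT
  have hsurj : Set.SurjOn (fun q : Σ _ : Finset α, Finset α × α => insert q.2.2 q.2.1) (T : Set _)
      (((R3 M τ).filter (fun S => 4 ≤ S.card ∧ kcol M S = 1)) : Set (Finset α)) := by
    intro S hS
    rw [Finset.mem_coe, Finset.mem_filter] at hS
    obtain ⟨hS3, h4, hk⟩ := hS
    obtain ⟨hSτ, hr3⟩ := mem_R3.1 hS3
    unfold kcol at hk
    obtain ⟨y, hy⟩ := Finset.card_eq_one.1 hk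
    have hyS : y ∈ S ∧ M.eRk ((S.erase y : Finset α) : Set α) ≤ 2 :=
      Finset.mem_filter.1 (hy ▸ Finset.mem_singleton_self y)
    have hCτ : S.erase y ⊆ τ := (Finset.erase_subset y S).trans hSτ
    have hC3 : 3 ≤ (S.erase y).card := by rw [Finset.card_erase_of_mem hyS.1]; omega
    have hCr : M.eRk ((S.erase y : Finset α) : Set α) = 2 :=
      le_antisymm hyS.2 (two_le_eRk_of_two_le_card hs hτ hCτ (by omega))
    have hL := clF_mem_lines (hCτ.trans hτ) hCr
    refine ⟨⟨clF M (S.erase y), (S.erase y, y)⟩, ?_, ?_⟩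
    · rw [Finset.mem_coe, hT, Finset.mem_sigma, Finset.mem_product, Finset.mem_filter, Finset.mem_powerset,
        Finset.mem_sdiff]
      refine ⟨hL.1, ⟨Finset.subset_inter hL.2 hCτ, hC3⟩, hSτ hyS.1, ?_⟩
      intro hyL
      have hsub : (S : Set α) ⊆ M.closure ((S.erase y : Finset α) : Set α) := by
        intro z hz
        rw [Finset.mem_coe] at hz
        by_cases hzy : z = y
        · subst hzy
          rw [← coe_clF]
          exact Finset.mem_coe.2 hyL
        · exact M.subset_closure _ (by rw [← coe_gr]; exact_mod_cast hCτ.trans hτ)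
            (Finset.mem_coe.2 (Finset.mem_erase.2 ⟨hzy, hz⟩))
      have h3 : M.eRk (S : Set α) ≤ 2 := by
        calc M.eRk (S : Set α) ≤ M.eRk (M.closure ((S.erase y : Finset α) : Set α)) := M.eRk_mono hsub
          _ = M.eRk ((S.erase y : Finset α) : Set α) := M.eRk_closure_eq _
          _ ≤ 2 := hyS.2
      rw [hr3] at h3
      exact absurd h3 (by decide)
    · simp only
      exact Finset.insert_erase hyS.1
  have hcard : LPcnt M τ ≤ T.card := Finset.card_le_card_of_surjOn _ hsurj
  have hTcard : T.card = ∑ L ∈ lines M, eps (L ∩ τ).card * (τ.card - (L ∩ τ).card) := by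
    rw [hT, Finset.card_sigma]
    refine Finset.sum_congr rfl (fun L _ => ?_)
    rw [Finset.card_product, card_powerset_filter_three_le]
    congr 1
    have := Finset.card_sdiff_add_card_inter τ L
    rw [Finset.inter_comm] at this
    omega
  have e := sum_lines_eq_sum_inc (M := M) τ (fun n => eps n * (τ.card - n))
  rw [e, sum_inc_range_eight' hr h8] at hTcard
  have he : eps 0 = 0 ∧ eps 1 = 0 ∧ eps 2 = 0 ∧ eps 3 = 1 ∧ eps 4 = 5 ∧ eps 5 = 16 ∧ eps 6 = 42 := by decide
  obtain ⟨e0, e1, e2, e3, e4, e5, e6⟩ := he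
  simp only [Finset.sum_range_succ, Finset.sum_range_zero, e0, e1, e2, e3, e4, e5, e6, hi7, mul_zero, zero_add,
    zero_mul, add_zero, one_mul] at hTcard
  unfold LPProf
  rw [hTcard] at hcard
  have hz := (Nat.cast_le (α := ℤ)).2 hcard
  push_cast at hz ⊢
  linarith

end Counts

end PercRepro.SixFour
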